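import Mathlib
import HarnessLib
import Summits.NavierStokesRegularity.NavierStokesRegularity.Theorems.PoloidalWindowDoorPoloidalWindowRigidityZShockSlopeFunctionConnected
import Summits.NavierStokesRegularity.NavierStokesRegularity.Theorems.PoloidalWindowDoorPoloidalWindowRigidityZShockHeightEvolution
import Summits.NavierStokesRegularity.NavierStokesRegularity.Theorems.PoloidalWindowDoorPoloidalWindowRigidityZShockEllipticPocket
import Summits.NavierStokesRegularity.NavierStokesRegularity.Theorems.PoloidalWindowDoorPoloidalWindowRigidityConstantShearMeans

/-!
# Crux K2 `PoloidalWindowRigidity` (stmt-NavierStokesRegularity-19708), line `z_shock` — SONIC VALUES ARE ISOLATED: at the densely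
# hyperbolic time the autonomous height evolution is hyperbolic on every non-degenerate component except on level sets of isolated values

`--supports stmt-NavierStokesRegularity-19708 --as helper` (leafhand-ns-poloidalwindowdoor-3 g1, cell decomp-ns, 2026-08-31).
**No stub and no summit is closed by this file; Navier–Stokes regularity is NOT proved here.**

Input of rung R3 of the deciding stub `stub_zShockThickAut` (skeleton `Cruxes/PoloidalWindowRigidity/Lines/z_shock.lean`, sha16 c3e8eee2), as
typed in the tree: at the window time `t₀ = z₀.1`, on every open connected `Ω ⊆ {∇ₕv₂(t₀,·) ≠ 0}` there is ONE slope function `G`,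
real-analytic at the values, with `∂_z v_b = G(v₂)·∂_b v₂` (`…ZShockSlopeFunctionConnected.autonomy_on_connected_of_class_autonomy`) and the
height-evolution `w_zz + divₕ(G(w)∇ₕw) = 0` (`…ZShockHeightEvolution`); the stub's `hdense` says the slice has NO strictly elliptic point,
`E(t₀,·) = ∂₂v₀∂₀v₂ + ∂₂v₁∂₁v₂ ≤ 0` on `ℝ³` (`…ZShockEllipticPocket.hypDiscriminant_nonpos_of_dense`).  On `Ω` the discriminant factors,
`E = G(w)·|∇ₕw|²`, so `G ≤ 0` at every value attained on `Ω` — the equation is hyperbolic (`G < 0`) or SONIC (`G = 0`) there.  This file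
shows that the sonic values are ISOLATED:

* `slope_nonpos_of_discriminant_nonpos` (arithmetic): `N_b = c·D_b`, `(D₀,D₁) ≠ 0`, `N₀D₀ + N₁D₁ ≤ 0 ⇒ c ≤ 0`.
* `range_eq_top_of_apply_ne_zero` (linear algebra): a real linear functional that does not vanish is onto.
* `sonicValues_isolated` (class-free core): `f : ℝ³ → ℝ³` real-analytic, slope law with `G` analytic at the values on an open `Ω` where
  `∇ₕf₂ ≠ 0`, discriminant `≤ 0` everywhere and `< 0` somewhere ⟹ for every `x ∈ Ω`: `G(f₂ x) ≤ 0` and `G(c) < 0` for all `c ≠ f₂ x` near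
  `f₂ x`.  (If `G` vanished on values accumulating at `f₂ x` it would vanish near `f₂ x` (isolated zeros of analytic functions), hence the
  discriminant would vanish near `x`, hence identically on `ℝ³` (identity theorem) — contradicting the strictly hyperbolic point; the values
  near `f₂ x` are attained near `x` because `Df₂(x) ≠ 0` makes `f₂` open at `x`, `HasStrictFDerivAt.map_nhds_eq_of_surj`.)
* `sonicValues_isolated_of_class` (class entry, binders VERBATIM from `stub_zShockThickAut`: class, window `W ⊆ {t<0}×ℝ³` hyperbolic,
  `z₀ ∈ W`, `hdense` at `z₀`, the local autonomy clause at `z₀`): on every open connected `Ω ⊆ {∇ₕv₂(t₀,·) ≠ 0}` the slope function `G` of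
  L0(c) satisfies `G(v₂(t₀,x)) ≤ 0` and `G < 0` on a punctured neighbourhood of every value `v₂(t₀,x)`, `x ∈ Ω`.

So the object R3 must rule out is: a bounded entire real-analytic solution of an autonomous quasilinear equation in the height which, on each
non-degenerate component, is STRICTLY HYPERBOLIC off the level sets `{w = c}` of a set of sonic values `c` without accumulation point at any
attained value (degenerate hyperbolicity only across isolated sonic leaves).  HONEST LABEL: S/M-sized structural lemma; R3 itself (XL,
not in print), the residues and crux 19708 stay OPEN.  presearch: elementary (isolated zeros `AnalyticAt.eventually_eq_zero_or_eventually_ne_zero`,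
open mapping at a submersion point `HasStrictFDerivAt.map_nhds_eq_of_surj`); nothing to cite. [folklore]
-/

noncomputable section

namespace Summit.NavierStokesRegularity.NavierStokesRegularity.Theorems.PoloidalWindowDoorPoloidalWindowRigidityZShockSonicValues

-- the problem directory repeats the summit name (`NavierStokesRegularity/NavierStokesRegularity`)
set_option linter.dupNamespace false

open Set Filter Topology Function Metric
open Literature.Analysis Literature.Analysis.FluidPDE
open Summit.NavierStokesRegularity.NavierStokesRegularity.Theorems.LocalSineTubeDoorProfileAlignedWindowRigidityAncient
open Summit.NavierStokesRegularity.NavierStokesRegularity.Theorems.PoloidalWindowDoorPoloidalWindowRigidityHorizontalSourceGauge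
  (analyticOnNhd_fderiv_apply_coord)
open Summit.NavierStokesRegularity.NavierStokesRegularity.Theorems.PoloidalWindowDoorPoloidalWindowRigidityConstantShearMeans
  (fderiv_coord_apply)
open Summit.NavierStokesRegularity.NavierStokesRegularity.Theorems.PoloidalWindowDoorPoloidalWindowRigidityZShockSlopeFunctionConnected
open Summit.NavierStokesRegularity.NavierStokesRegularity.Theorems.PoloidalWindowDoorPoloidalWindowRigidityZShockEllipticPocket

/-! ## Two elementary lemmas -/

/-- If `N_b = c·D_b` (`b = 0,1`), `(D₀, D₁) ≠ 0` and `N₀D₀ + N₁D₁ ≤ 0`, then `c ≤ 0`. [folklore] -/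
theorem slope_nonpos_of_discriminant_nonpos {N₀ N₁ D₀ D₁ c : ℝ} (h0 : N₀ = c * D₀) (h1 : N₁ = c * D₁)
    (hD : D₀ ≠ 0 ∨ D₁ ≠ 0) (hE : N₀ * D₀ + N₁ * D₁ ≤ 0) : c ≤ 0 := by
  have hsum : N₀ * D₀ + N₁ * D₁ = c * (D₀ ^ 2 + D₁ ^ 2) := by rw [h0, h1]; ring
  have hpos : 0 < D₀ ^ 2 + D₁ ^ 2 := by
    rcases hD with h | h
    · have := sq_pos_of_ne_zero h; positivity
    · have := sq_pos_of_ne_zero h; positivity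
  rw [hsum] at hE
  by_contra hc
  push Not at hc
  have : 0 < c * (D₀ ^ 2 + D₁ ^ 2) := mul_pos hc hpos
  linarith

/-- A real continuous linear functional that does not vanish at some vector is onto. [folklore] -/
theorem range_eq_top_of_apply_ne_zero {F : Type*} [NormedAddCommGroup F] [NormedSpace ℝ F] (ℓ : F →L[ℝ] ℝ) {u : F}
    (hu : ℓ u ≠ 0) : LinearMap.range (ℓ : F →ₗ[ℝ] ℝ) = ⊤ := by
  refine LinearMap.range_eq_top.2 fun c => ⟨(c / ℓ u) • u, ?_⟩
  simp only [ContinuousLinearMap.coe_coe, map_smul, smul_eq_mul]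
  exact div_mul_cancel₀ c hu

/-! ## The class-free core on an analytic slice -/

/-- **Sonic values are isolated (class-free).**  Let `f : ℝ³ → ℝ³` be real-analytic; on an open `Ω` let the slope law
`∂_z f_b = G(f₂)·∂_b f₂` (`b ≠ 2`) hold with `G` real-analytic at the values and `∇ₕf₂ ≠ 0`; suppose the discriminant
`E = ∂₂f₀·∂₀f₂ + ∂₂f₁·∂₁f₂` is `≤ 0` on `ℝ³` and `< 0` at some point.  Then for every `x ∈ Ω`: `G(f₂(x)) ≤ 0`, and `G(c) < 0` for all
`c ≠ f₂(x)` in a neighbourhood of `f₂(x)`. [folklore] -/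
theorem sonicValues_isolated {f : EuclideanSpace ℝ (Fin 3) → EuclideanSpace ℝ (Fin 3)} (hf : AnalyticOnNhd ℝ f univ)
    {Ω : Set (EuclideanSpace ℝ (Fin 3))} (hΩo : IsOpen Ω) {G : ℝ → ℝ}
    (hGan : ∀ x ∈ Ω, AnalyticAt ℝ G (f x 2))
    (hslope : ∀ x ∈ Ω, ∀ b : Fin 3, b ≠ 2 →
      fderiv ℝ f x (EuclideanSpace.single 2 1) b = G (f x 2) * fderiv ℝ f x (EuclideanSpace.single b 1) 2)
    (hnd : ∀ x ∈ Ω, fderiv ℝ f x (EuclideanSpace.single 0 1) 2 ≠ 0 ∨ fderiv ℝ f x (EuclideanSpace.single 1 1) 2 ≠ 0)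
    (hE : ∀ y, fderiv ℝ f y (EuclideanSpace.single 2 1) 0 * fderiv ℝ f y (EuclideanSpace.single 0 1) 2 +
        fderiv ℝ f y (EuclideanSpace.single 2 1) 1 * fderiv ℝ f y (EuclideanSpace.single 1 1) 2 ≤ 0)
    (hx₀ : ∃ x₀, fderiv ℝ f x₀ (EuclideanSpace.single 2 1) 0 * fderiv ℝ f x₀ (EuclideanSpace.single 0 1) 2 +
        fderiv ℝ f x₀ (EuclideanSpace.single 2 1) 1 * fderiv ℝ f x₀ (EuclideanSpace.single 1 1) 2 < 0) :
    ∀ x ∈ Ω, G (f x 2) ≤ 0 ∧ ∀ᶠ c in 𝓝[≠] (f x 2), G c < 0 := by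
  -- the discriminant as an analytic function on `ℝ³`
  set E : EuclideanSpace ℝ (Fin 3) → ℝ := fun y =>
    fderiv ℝ f y (EuclideanSpace.single 2 1) 0 * fderiv ℝ f y (EuclideanSpace.single 0 1) 2 +
      fderiv ℝ f y (EuclideanSpace.single 2 1) 1 * fderiv ℝ f y (EuclideanSpace.single 1 1) 2 with hEdef
  have hEan : AnalyticOnNhd ℝ E univ :=
    ((analyticOnNhd_fderiv_apply_coord hf _ 0).mul (analyticOnNhd_fderiv_apply_coord hf _ 2)).add
      ((analyticOnNhd_fderiv_apply_coord hf _ 1).mul (analyticOnNhd_fderiv_apply_coord hf _ 2))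
  -- (a) `G ≤ 0` at every value attained on `Ω`
  have hGle : ∀ x ∈ Ω, G (f x 2) ≤ 0 := fun x hx =>
    slope_nonpos_of_discriminant_nonpos (hslope x hx 0 (by decide)) (hslope x hx 1 (by decide)) (hnd x hx) (hE x)
  intro x hx
  refine ⟨hGle x hx, ?_⟩
  -- the height component `w = f₂` and its openness at `x`
  set w : EuclideanSpace ℝ (Fin 3) → ℝ := fun y => f y 2 with hwdef
  have hfx : AnalyticAt ℝ f x := hf x (mem_univ _)
  have hwan : AnalyticAt ℝ w x := ((EuclideanSpace.proj (𝕜 := ℝ) (2 : Fin 3)).analyticAt _).comp hfx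
  have hwcont : ContinuousAt w x := hwan.continuousAt
  -- (b) values near `w x` are attained on `Ω` near `x`, so `G ≤ 0` near `w x`
  have hGle_near : ∀ᶠ c in 𝓝 (w x), G c ≤ 0 := by
    -- strict derivative of `w` at `x` and its surjectivity
    have hfd : HasStrictFDerivAt f (fderiv ℝ f x) x := (hfx.contDiffAt (n := 1)).hasStrictFDerivAt one_ne_zero
    have hwd : HasStrictFDerivAt w ((EuclideanSpace.proj (𝕜 := ℝ) (2 : Fin 3)).comp (fderiv ℝ f x)) x :=
      ((EuclideanSpace.proj (𝕜 := ℝ) (2 : Fin 3)).hasStrictFDerivAt).comp x hfd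
    have hsurj : LinearMap.range
        (((EuclideanSpace.proj (𝕜 := ℝ) (2 : Fin 3)).comp (fderiv ℝ f x) :
          EuclideanSpace ℝ (Fin 3) →L[ℝ] ℝ) : EuclideanSpace ℝ (Fin 3) →ₗ[ℝ] ℝ) = ⊤ := by
      rcases hnd x hx with h | h
      · exact range_eq_top_of_apply_ne_zero _ (u := EuclideanSpace.single 0 1) (by simpa using h)
      · exact range_eq_top_of_apply_ne_zero _ (u := EuclideanSpace.single 1 1) (by simpa using h)
    have hmap : map w (𝓝 x) = 𝓝 (w x) := hwd.map_nhds_eq_of_surj hsurj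
    have himg : w '' Ω ∈ 𝓝 (w x) := by
      rw [← hmap]
      exact image_mem_map (hΩo.mem_nhds hx)
    filter_upwards [himg] with c hc
    obtain ⟨y, hyΩ, hyc⟩ := hc
    rw [← hyc]
    exact hGle y hyΩ
  -- (c) `G` does not vanish identically near `w x`: otherwise `E ≡ 0` near `x`, hence on `ℝ³`
  rcases (hGan x hx).eventually_eq_zero_or_eventually_ne_zero with hG0 | hGne
  · exfalso
    have hG0' : ∀ᶠ y in 𝓝 x, G (w y) = 0 := hwcont.eventually hG0
    have hE0 : E =ᶠ[𝓝 x] 0 := by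
      filter_upwards [hG0', hΩo.mem_nhds hx] with y hyG hyΩ
      show fderiv ℝ f y (EuclideanSpace.single 2 1) 0 * fderiv ℝ f y (EuclideanSpace.single 0 1) 2 +
          fderiv ℝ f y (EuclideanSpace.single 2 1) 1 * fderiv ℝ f y (EuclideanSpace.single 1 1) 2 = (0 : EuclideanSpace ℝ (Fin 3) → ℝ) y
      rw [hslope y hyΩ 0 (by decide), hslope y hyΩ 1 (by decide)]
      have : G (f y 2) = 0 := hyG
      rw [this]; simp
    have hEz : EqOn E 0 univ :=
      hEan.eqOn_zero_of_preconnected_of_eventuallyEq_zero (convex_univ.isPreconnected) (mem_univ x) hE0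
    obtain ⟨x₀, hx₀⟩ := hx₀
    have h0 : E x₀ = 0 := hEz (mem_univ x₀)
    exact absurd h0 (ne_of_lt hx₀)
  · -- combine: near `w x`, off `w x`, `G ≠ 0` and `G ≤ 0`
    have hle' : ∀ᶠ c in 𝓝[≠] (w x), G c ≤ 0 := nhdsWithin_le_nhds hGle_near
    filter_upwards [hGne, hle'] with c hne hle
    exact lt_of_le_of_ne hle hne

/-! ## Class entry: the deciding stub's slice -/

/-- **Sonic values are isolated on the densely hyperbolic slice of `stub_zShockThickAut`.**  Class binders VERBATIM (Type-I rate, continuity,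
Oseen identity (M), divergence-free, poloidal), a space–time window `W ⊆ {t<0} × ℝ³` on which the slice is strictly hyperbolic (the stub's
`hhyp`), a window point `z₀ ∈ W` with densely hyperbolic slice (`hdense`) and the stub's LOCAL autonomy clause at `z₀` (`∃ g W₁, …`).  Then on
every open connected `Ω ⊆ {∇ₕv₂(t₀,·) ≠ 0}` (`t₀ = z₀.1`) there is ONE `G`, real-analytic at the values, with the slope law
`∂_z v_b = G(v₂)·∂_b v₂` on `Ω`, `G(v₂(t₀,x)) ≤ 0` for every `x ∈ Ω`, and `G < 0` on a punctured neighbourhood of every attained value: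
the autonomous height evolution of R3 is strictly hyperbolic on `Ω` off the level sets of isolated sonic values. [folklore] -/
theorem sonicValues_isolated_of_class (C : ℝ) (v : ℝ → EuclideanSpace ℝ (Fin 3) → EuclideanSpace ℝ (Fin 3))
    (hrate : HasTypeITimeDecay C v) (hcont : ContinuousOn (uncurry v) (Iio (0 : ℝ) ×ˢ univ))
    (hmild : ∀ s t : ℝ, s < t → t < 0 → ∀ x, v t x =
      UnboundedOperators.heatExtension (v s) (t - s) x - oseenDuhamel 1 s v v t x)
    (hdiv : ∀ t < 0, VectorCalculus.IsDivFree (v t))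
    (hpol : ∀ s < 0, ∀ y, inner ℝ (curl (v s) y) (EuclideanSpace.single 2 1) = 0)
    (W : Set (ℝ × EuclideanSpace ℝ (Fin 3))) (hWs : W ⊆ Iio (0 : ℝ) ×ˢ univ)
    (hhyp : ∀ z ∈ W,
      fderiv ℝ (v z.1) z.2 (EuclideanSpace.single 2 1) 0 * fderiv ℝ (v z.1) z.2 (EuclideanSpace.single 0 1) 2 +
        fderiv ℝ (v z.1) z.2 (EuclideanSpace.single 2 1) 1 * fderiv ℝ (v z.1) z.2 (EuclideanSpace.single 1 1) 2 < 0)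
    (z₀ : ℝ × EuclideanSpace ℝ (Fin 3)) (hz₀ : z₀ ∈ W)
    (hdense : Dense {y : EuclideanSpace ℝ (Fin 3) |
      fderiv ℝ (v z₀.1) y (EuclideanSpace.single 2 1) 0 * fderiv ℝ (v z₀.1) y (EuclideanSpace.single 0 1) 2 +
        fderiv ℝ (v z₀.1) y (EuclideanSpace.single 2 1) 1 * fderiv ℝ (v z₀.1) y (EuclideanSpace.single 1 1) 2 < 0})
    (haut : ∃ g : ℝ → ℝ → ℝ, ∃ W₁ : Set (ℝ × EuclideanSpace ℝ (Fin 3)), W₁ ⊆ W ∧ IsOpen W₁ ∧ z₀ ∈ W₁ ∧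
      ∀ z ∈ W₁, ∀ b : Fin 3, b ≠ 2 →
        fderiv ℝ (v z.1) z.2 (EuclideanSpace.single 2 1) b =
          g z.1 (v z.1 z.2 2) * fderiv ℝ (v z.1) z.2 (EuclideanSpace.single b 1) 2)
    {Ω : Set (EuclideanSpace ℝ (Fin 3))} (hΩ : IsPreconnected Ω) (hΩo : IsOpen Ω)
    (hΩnd : ∀ x ∈ Ω, fderiv ℝ (v z₀.1) x (EuclideanSpace.single 0 1) 2 ≠ 0 ∨
      fderiv ℝ (v z₀.1) x (EuclideanSpace.single 1 1) 2 ≠ 0) :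
    ∃ G : ℝ → ℝ, (∀ x ∈ Ω, AnalyticAt ℝ G (v z₀.1 x 2)) ∧
      (∀ x ∈ Ω, ∀ b : Fin 3, b ≠ 2 → fderiv ℝ (v z₀.1) x (EuclideanSpace.single 2 1) b =
        G (v z₀.1 x 2) * fderiv ℝ (v z₀.1) x (EuclideanSpace.single b 1) 2) ∧
      ∀ x ∈ Ω, G (v z₀.1 x 2) ≤ 0 ∧ ∀ᶠ c in 𝓝[≠] (v z₀.1 x 2), G c < 0 := by
  obtain ⟨g, W₁, hW₁W, hW₁, hz₀W₁, hg⟩ := haut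
  have hW₁s : W₁ ⊆ Iio (0 : ℝ) ×ˢ univ := hW₁W.trans hWs
  obtain ⟨G, hGA, hG⟩ :=
    autonomy_on_connected_of_class_autonomy C v hrate hcont hmild hdiv hpol hW₁ hW₁s hz₀W₁ hg hΩ hΩo hΩnd
  have ht₀ : z₀.1 < 0 := (mem_prod.1 (hWs hz₀)).1
  have han : AnalyticOnNhd ℝ (v z₀.1) univ := analyticOnNhd_slice hcont (bdd_of_hasTypeITimeDecay hrate) hmild ht₀
  have hE : ∀ y : EuclideanSpace ℝ (Fin 3),
      fderiv ℝ (v z₀.1) y (EuclideanSpace.single 2 1) 0 * fderiv ℝ (v z₀.1) y (EuclideanSpace.single 0 1) 2 +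
        fderiv ℝ (v z₀.1) y (EuclideanSpace.single 2 1) 1 * fderiv ℝ (v z₀.1) y (EuclideanSpace.single 1 1) 2 ≤ 0 :=
    hypDiscriminant_nonpos_of_dense hrate hcont hmild ht₀ hdense
  exact ⟨G, hGA, hG, sonicValues_isolated han hΩo hGA hG hΩnd hE ⟨z₀.2, hhyp z₀ hz₀⟩⟩

/-! ## Appendix (same seat, same session): genuinely nonlinear on the component, or a GLOBAL constant-slope (TH) slice -/

/-- **Values attained on a non-degenerate open set form a neighbourhood of each of them** (the height component is a submersion where
`∇ₕf₂ ≠ 0`; `HasStrictFDerivAt.map_nhds_eq_of_surj`). [folklore] -/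
theorem image_heightComponent_mem_nhds {f : EuclideanSpace ℝ (Fin 3) → EuclideanSpace ℝ (Fin 3)} (hf : AnalyticOnNhd ℝ f univ)
    {Ω : Set (EuclideanSpace ℝ (Fin 3))} (hΩo : IsOpen Ω)
    (hnd : ∀ x ∈ Ω, fderiv ℝ f x (EuclideanSpace.single 0 1) 2 ≠ 0 ∨ fderiv ℝ f x (EuclideanSpace.single 1 1) 2 ≠ 0)
    {x : EuclideanSpace ℝ (Fin 3)} (hx : x ∈ Ω) :
    (fun y => f y 2) '' Ω ∈ 𝓝 (f x 2) := by
  have hfx : AnalyticAt ℝ f x := hf x (mem_univ _)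
  have hfd : HasStrictFDerivAt f (fderiv ℝ f x) x := (hfx.contDiffAt (n := 1)).hasStrictFDerivAt one_ne_zero
  have hwd : HasStrictFDerivAt (fun y => f y 2) ((EuclideanSpace.proj (𝕜 := ℝ) (2 : Fin 3)).comp (fderiv ℝ f x)) x :=
    ((EuclideanSpace.proj (𝕜 := ℝ) (2 : Fin 3)).hasStrictFDerivAt).comp x hfd
  have hsurj : LinearMap.range
      (((EuclideanSpace.proj (𝕜 := ℝ) (2 : Fin 3)).comp (fderiv ℝ f x) :
        EuclideanSpace ℝ (Fin 3) →L[ℝ] ℝ) : EuclideanSpace ℝ (Fin 3) →ₗ[ℝ] ℝ) = ⊤ := by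
    rcases hnd x hx with h | h
    · exact range_eq_top_of_apply_ne_zero _ (u := EuclideanSpace.single 0 1) (by simpa using h)
    · exact range_eq_top_of_apply_ne_zero _ (u := EuclideanSpace.single 1 1) (by simpa using h)
  have hmap : map (fun y => f y 2) (𝓝 x) = 𝓝 (f x 2) := hwd.map_nhds_eq_of_surj hsurj
  rw [← hmap]
  exact image_mem_map (hΩo.mem_nhds hx)

/-- The set of values attained on a non-degenerate open set is open. [folklore] -/
theorem isOpen_image_heightComponent {f : EuclideanSpace ℝ (Fin 3) → EuclideanSpace ℝ (Fin 3)} (hf : AnalyticOnNhd ℝ f univ)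
    {Ω : Set (EuclideanSpace ℝ (Fin 3))} (hΩo : IsOpen Ω)
    (hnd : ∀ x ∈ Ω, fderiv ℝ f x (EuclideanSpace.single 0 1) 2 ≠ 0 ∨ fderiv ℝ f x (EuclideanSpace.single 1 1) 2 ≠ 0) :
    IsOpen ((fun y => f y 2) '' Ω) := by
  rw [isOpen_iff_mem_nhds]
  rintro _ ⟨x, hx, rfl⟩
  exact image_heightComponent_mem_nhds hf hΩo hnd hx

/-- **Dichotomy on a non-degenerate component (class-free).**  In the setting of `sonicValues_isolated` with `Ω` connected and nonempty:
EITHER the slope function is genuinely nonlinear at some value attained on `Ω` (`G'(f₂ x) ≠ 0` for some `x ∈ Ω` — the case rung R3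
addresses), OR `G` is a NEGATIVE CONSTANT `−c` on the values of `Ω` and then, by the identity theorem, the constant-slope (TH) law
`∂_z f_b = −c·∂_b f₂` holds on ALL of `ℝ³` (a global (TH) slice with one slope at every height — the linearly degenerate column).
Proof of the second branch: `G' = 0` on the open interval `f₂(Ω)` makes `G` constant there (`IsOpen.exists_is_const_of_deriv_eq_zero`); the
constant is `≤ 0` by `sonicValues_isolated` and `≠ 0` since otherwise the discriminant would vanish on `Ω`, hence identically. [folklore] -/
theorem deriv_ne_zero_or_global_constSlope {f : EuclideanSpace ℝ (Fin 3) → EuclideanSpace ℝ (Fin 3)} (hf : AnalyticOnNhd ℝ f univ)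
    {Ω : Set (EuclideanSpace ℝ (Fin 3))} (hΩ : IsPreconnected Ω) (hΩo : IsOpen Ω) (hΩne : Ω.Nonempty) {G : ℝ → ℝ}
    (hGan : ∀ x ∈ Ω, AnalyticAt ℝ G (f x 2))
    (hslope : ∀ x ∈ Ω, ∀ b : Fin 3, b ≠ 2 →
      fderiv ℝ f x (EuclideanSpace.single 2 1) b = G (f x 2) * fderiv ℝ f x (EuclideanSpace.single b 1) 2)
    (hnd : ∀ x ∈ Ω, fderiv ℝ f x (EuclideanSpace.single 0 1) 2 ≠ 0 ∨ fderiv ℝ f x (EuclideanSpace.single 1 1) 2 ≠ 0)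
    (hE : ∀ y, fderiv ℝ f y (EuclideanSpace.single 2 1) 0 * fderiv ℝ f y (EuclideanSpace.single 0 1) 2 +
        fderiv ℝ f y (EuclideanSpace.single 2 1) 1 * fderiv ℝ f y (EuclideanSpace.single 1 1) 2 ≤ 0)
    (hx₀ : ∃ x₀, fderiv ℝ f x₀ (EuclideanSpace.single 2 1) 0 * fderiv ℝ f x₀ (EuclideanSpace.single 0 1) 2 +
        fderiv ℝ f x₀ (EuclideanSpace.single 2 1) 1 * fderiv ℝ f x₀ (EuclideanSpace.single 1 1) 2 < 0) :
    (∃ x ∈ Ω, deriv G (f x 2) ≠ 0) ∨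
      ∃ c : ℝ, 0 < c ∧ (∀ x ∈ Ω, G (f x 2) = -c) ∧
        ∀ y : EuclideanSpace ℝ (Fin 3), ∀ b : Fin 3, b ≠ 2 →
          fderiv ℝ f y (EuclideanSpace.single 2 1) b = -c * fderiv ℝ f y (EuclideanSpace.single b 1) 2 := by
  by_cases hgn : ∃ x ∈ Ω, deriv G (f x 2) ≠ 0
  · exact Or.inl hgn
  right
  push Not at hgn
  -- the value set `S = f₂(Ω)` is open, preconnected, and `G` is constant on it
  set S : Set ℝ := (fun y => f y 2) '' Ω with hSdef
  have hSo : IsOpen S := isOpen_image_heightComponent hf hΩo hnd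
  have hwcont : Continuous fun y => f y 2 :=
    ((EuclideanSpace.proj (𝕜 := ℝ) (2 : Fin 3)).continuous).comp hf.continuous
  have hSc : IsPreconnected S := hΩ.image _ hwcont.continuousOn
  have hGd : DifferentiableOn ℝ G S := by
    rintro _ ⟨x, hx, rfl⟩
    exact (hGan x hx).differentiableAt.differentiableWithinAt
  have hG' : S.EqOn (deriv G) 0 := by
    rintro _ ⟨x, hx, rfl⟩
    exact hgn x hx
  obtain ⟨a, ha⟩ := hSo.exists_is_const_of_deriv_eq_zero hSc hGd hG'
  have haΩ : ∀ x ∈ Ω, G (f x 2) = a := fun x hx => ha _ ⟨x, hx, rfl⟩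
  -- `a ≤ 0` (no elliptic point) and `a ≠ 0` (else the discriminant vanishes on `Ω`, hence everywhere)
  obtain ⟨x₁, hx₁⟩ := hΩne
  have hale : a ≤ 0 := by
    rw [← haΩ x₁ hx₁]; exact (sonicValues_isolated hf hΩo hGan hslope hnd hE hx₀ x₁ hx₁).1
  have hane : a ≠ 0 := by
    intro ha0
    have hE0 : (fun y => fderiv ℝ f y (EuclideanSpace.single 2 1) 0 * fderiv ℝ f y (EuclideanSpace.single 0 1) 2 +
        fderiv ℝ f y (EuclideanSpace.single 2 1) 1 * fderiv ℝ f y (EuclideanSpace.single 1 1) 2) =ᶠ[𝓝 x₁] 0 := by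
      filter_upwards [hΩo.mem_nhds hx₁] with y hyΩ
      show fderiv ℝ f y (EuclideanSpace.single 2 1) 0 * fderiv ℝ f y (EuclideanSpace.single 0 1) 2 +
          fderiv ℝ f y (EuclideanSpace.single 2 1) 1 * fderiv ℝ f y (EuclideanSpace.single 1 1) 2 = (0 : EuclideanSpace ℝ (Fin 3) → ℝ) y
      rw [hslope y hyΩ 0 (by decide), hslope y hyΩ 1 (by decide), haΩ y hyΩ, ha0]
      simp
    have hEan : AnalyticOnNhd ℝ (fun y => fderiv ℝ f y (EuclideanSpace.single 2 1) 0 * fderiv ℝ f y (EuclideanSpace.single 0 1) 2 +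
        fderiv ℝ f y (EuclideanSpace.single 2 1) 1 * fderiv ℝ f y (EuclideanSpace.single 1 1) 2) univ :=
      ((analyticOnNhd_fderiv_apply_coord hf _ 0).mul (analyticOnNhd_fderiv_apply_coord hf _ 2)).add
        ((analyticOnNhd_fderiv_apply_coord hf _ 1).mul (analyticOnNhd_fderiv_apply_coord hf _ 2))
    have hEz := hEan.eqOn_zero_of_preconnected_of_eventuallyEq_zero (convex_univ.isPreconnected) (mem_univ x₁) hE0
    obtain ⟨x₀, hx₀⟩ := hx₀
    have h0 := hEz (mem_univ x₀)
    simp only [Pi.zero_apply] at h0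
    exact absurd h0 (ne_of_lt hx₀)
  have halt : a < 0 := lt_of_le_of_ne hale hane
  refine ⟨-a, by linarith, fun x hx => by rw [haΩ x hx, neg_neg], ?_⟩
  -- globalise the constant-slope law by the identity theorem
  intro y b hb
  have hDan : AnalyticOnNhd ℝ (fun y => fderiv ℝ f y (EuclideanSpace.single 2 1) b -
      a * fderiv ℝ f y (EuclideanSpace.single b 1) 2) univ :=
    (analyticOnNhd_fderiv_apply_coord hf _ b).sub
      (analyticOnNhd_const.mul (analyticOnNhd_fderiv_apply_coord hf _ 2))
  have hD0 : (fun y => fderiv ℝ f y (EuclideanSpace.single 2 1) b - a * fderiv ℝ f y (EuclideanSpace.single b 1) 2) =ᶠ[𝓝 x₁] 0 := by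
    filter_upwards [hΩo.mem_nhds hx₁] with y' hy'
    show fderiv ℝ f y' (EuclideanSpace.single 2 1) b - a * fderiv ℝ f y' (EuclideanSpace.single b 1) 2 = (0 : EuclideanSpace ℝ (Fin 3) → ℝ) y'
    rw [hslope y' hy' b hb, haΩ y' hy']
    simp
  have hDz := hDan.eqOn_zero_of_preconnected_of_eventuallyEq_zero (convex_univ.isPreconnected) (mem_univ x₁) hD0 (mem_univ y)
  simp only [Pi.zero_apply, sub_eq_zero] at hDz
  rw [hDz, neg_neg]

/-- **Dichotomy on the densely hyperbolic slice of `stub_zShockThickAut` (class entry).**  Binders as in `sonicValues_isolated_of_class`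
(class, hyperbolic window `W`, `z₀ ∈ W`, `hdense`, the local autonomy clause at `z₀`) and an open connected NONEMPTY `Ω ⊆ {∇ₕv₂(t₀,·) ≠ 0}`.
Then, with the slope function `G` of L0(c) on `Ω`: EITHER `G` is genuinely nonlinear at some value attained on `Ω` (`deriv G (v₂(t₀,x)) ≠ 0`,
the object of rung R3), OR the whole slice `v(t₀,·)` obeys a GLOBAL constant-slope (TH) law `∂_z v_b = −c·∂_b v₂` on `ℝ³` with ONE `c > 0`
— in which case it solves the LINEAR wave equation `∂₂²v₂ = c·Δₕv₂` on all of `ℝ³` (the linearly degenerate (TH) column at the instant `t₀`,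
cf. `…ZShockThickInstants`: such instants are isolated in `t`). [folklore] -/
theorem gn_or_globalTH_of_class (C : ℝ) (v : ℝ → EuclideanSpace ℝ (Fin 3) → EuclideanSpace ℝ (Fin 3))
    (hrate : HasTypeITimeDecay C v) (hcont : ContinuousOn (uncurry v) (Iio (0 : ℝ) ×ˢ univ))
    (hmild : ∀ s t : ℝ, s < t → t < 0 → ∀ x, v t x =
      UnboundedOperators.heatExtension (v s) (t - s) x - oseenDuhamel 1 s v v t x)
    (hdiv : ∀ t < 0, VectorCalculus.IsDivFree (v t))
    (hpol : ∀ s < 0, ∀ y, inner ℝ (curl (v s) y) (EuclideanSpace.single 2 1) = 0)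
    (W : Set (ℝ × EuclideanSpace ℝ (Fin 3))) (hWs : W ⊆ Iio (0 : ℝ) ×ˢ univ)
    (hhyp : ∀ z ∈ W,
      fderiv ℝ (v z.1) z.2 (EuclideanSpace.single 2 1) 0 * fderiv ℝ (v z.1) z.2 (EuclideanSpace.single 0 1) 2 +
        fderiv ℝ (v z.1) z.2 (EuclideanSpace.single 2 1) 1 * fderiv ℝ (v z.1) z.2 (EuclideanSpace.single 1 1) 2 < 0)
    (z₀ : ℝ × EuclideanSpace ℝ (Fin 3)) (hz₀ : z₀ ∈ W)
    (hdense : Dense {y : EuclideanSpace ℝ (Fin 3) |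
      fderiv ℝ (v z₀.1) y (EuclideanSpace.single 2 1) 0 * fderiv ℝ (v z₀.1) y (EuclideanSpace.single 0 1) 2 +
        fderiv ℝ (v z₀.1) y (EuclideanSpace.single 2 1) 1 * fderiv ℝ (v z₀.1) y (EuclideanSpace.single 1 1) 2 < 0})
    (haut : ∃ g : ℝ → ℝ → ℝ, ∃ W₁ : Set (ℝ × EuclideanSpace ℝ (Fin 3)), W₁ ⊆ W ∧ IsOpen W₁ ∧ z₀ ∈ W₁ ∧
      ∀ z ∈ W₁, ∀ b : Fin 3, b ≠ 2 →
        fderiv ℝ (v z.1) z.2 (EuclideanSpace.single 2 1) b =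
          g z.1 (v z.1 z.2 2) * fderiv ℝ (v z.1) z.2 (EuclideanSpace.single b 1) 2)
    {Ω : Set (EuclideanSpace ℝ (Fin 3))} (hΩ : IsPreconnected Ω) (hΩo : IsOpen Ω) (hΩne : Ω.Nonempty)
    (hΩnd : ∀ x ∈ Ω, fderiv ℝ (v z₀.1) x (EuclideanSpace.single 0 1) 2 ≠ 0 ∨
      fderiv ℝ (v z₀.1) x (EuclideanSpace.single 1 1) 2 ≠ 0) :
    ∃ G : ℝ → ℝ, (∀ x ∈ Ω, AnalyticAt ℝ G (v z₀.1 x 2)) ∧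
      (∀ x ∈ Ω, ∀ b : Fin 3, b ≠ 2 → fderiv ℝ (v z₀.1) x (EuclideanSpace.single 2 1) b =
        G (v z₀.1 x 2) * fderiv ℝ (v z₀.1) x (EuclideanSpace.single b 1) 2) ∧
      ((∃ x ∈ Ω, deriv G (v z₀.1 x 2) ≠ 0) ∨
        ∃ c : ℝ, 0 < c ∧ (∀ x ∈ Ω, G (v z₀.1 x 2) = -c) ∧
          (∀ y : EuclideanSpace ℝ (Fin 3), ∀ b : Fin 3, b ≠ 2 →
            fderiv ℝ (v z₀.1) y (EuclideanSpace.single 2 1) b = -c * fderiv ℝ (v z₀.1) y (EuclideanSpace.single b 1) 2) ∧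
          ∀ y : EuclideanSpace ℝ (Fin 3),
            fderiv ℝ (fun x => fderiv ℝ (v z₀.1) x (EuclideanSpace.single 2 1) 2) y (EuclideanSpace.single 2 1) =
              c * (fderiv ℝ (fun x => fderiv ℝ (v z₀.1) x (EuclideanSpace.single 0 1) 2) y (EuclideanSpace.single 0 1) +
                fderiv ℝ (fun x => fderiv ℝ (v z₀.1) x (EuclideanSpace.single 1 1) 2) y (EuclideanSpace.single 1 1))) := by
  obtain ⟨g, W₁, hW₁W, hW₁, hz₀W₁, hg⟩ := haut
  have hW₁s : W₁ ⊆ Iio (0 : ℝ) ×ˢ univ := hW₁W.trans hWs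
  obtain ⟨G, hGA, hG⟩ :=
    autonomy_on_connected_of_class_autonomy C v hrate hcont hmild hdiv hpol hW₁ hW₁s hz₀W₁ hg hΩ hΩo hΩnd
  have ht₀ : z₀.1 < 0 := (mem_prod.1 (hWs hz₀)).1
  have han : AnalyticOnNhd ℝ (v z₀.1) univ := analyticOnNhd_slice hcont (bdd_of_hasTypeITimeDecay hrate) hmild ht₀
  have hE : ∀ y : EuclideanSpace ℝ (Fin 3),
      fderiv ℝ (v z₀.1) y (EuclideanSpace.single 2 1) 0 * fderiv ℝ (v z₀.1) y (EuclideanSpace.single 0 1) 2 +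
        fderiv ℝ (v z₀.1) y (EuclideanSpace.single 2 1) 1 * fderiv ℝ (v z₀.1) y (EuclideanSpace.single 1 1) 2 ≤ 0 :=
    hypDiscriminant_nonpos_of_dense hrate hcont hmild ht₀ hdense
  refine ⟨G, hGA, hG, ?_⟩
  rcases deriv_ne_zero_or_global_constSlope han hΩ hΩo hΩne hGA hG hΩnd hE ⟨z₀.2, hhyp z₀ hz₀⟩ with hgn | ⟨c, hc, hGc, hlaw⟩
  · exact Or.inl hgn
  · refine Or.inr ⟨c, hc, hGc, hlaw, fun y => ?_⟩
    have hwave :=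
      Summit.NavierStokesRegularity.NavierStokesRegularity.Theorems.PoloidalWindowDoorPoloidalWindowRigidityZShockHeightEvolution.heightEvolution_of_slope_function
        han (hdiv z₀.1 ht₀) isOpen_univ (G := fun _ => -c) (G' := fun _ => 0)
        (fun y _ => hasDerivAt_const (v z₀.1 y 2) (-c)) (fun y _ b hb => hlaw y b hb) (mem_univ y)
    rw [hwave]
    ring

end Summit.NavierStokesRegularity.NavierStokesRegularity.Theorems.PoloidalWindowDoorPoloidalWindowRigidityZShockSonicValues

end
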